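import Mathlib
import HarnessLib
import Literature.Analysis.FluidPDE.Seregin2020AncientLimitAlong
import Summits.NavierStokesRegularity.NavierStokesRegularity.Theorems.LocalSineTubeDoorLocalPointZoomFrame
import Summits.NavierStokesRegularity.NavierStokesRegularity.Theorems.StableStrataDoorVertexBounds
import Summits.NavierStokesRegularity.NavierStokesRegularity.Theorems.StableStrataDoorHalfZoomRate

/-!
# StableStrataDoorZoomFrameAlong — the tree zoom frame at a LOCALLY (space–time) Type I point ALONG PRESCRIBED TIMES,
# with a UNIFORM `L³`-floor (SEED-26 input I1 v5 `LocalPointZoomAlongTimesM`, door S26 «StableStrataDoor»; nsreg-p6 g14)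

`localTreeZoomFrameAlong` = the lineage's `LocalSineTubeDoorLocalPointZoomFrame.localTreeZoomFrame` (steps (1)–(11):
A–B zoom, half-zoom `v'`, Seregin's singular-vertex data, zoom-in limit, slab class, rate a.e., profile representative,
identification of the zooms) with TWO changes:

* step (6) extracts the zoom-in limit ALONG THE PRESCRIBED SCALES `μₙ = 2√(ν(T−tₙ))/R` (for given physical times
  `tₙ → T⁻`), by `Literature…Seregin2020.exists_ancientLimit_along`; the returned scales `λⱼ = μ_{φ(j)}` satisfy
  `(Rλⱼ/2)² = ν (T − t_{φ j})`, i.e. physical time `t_{φ j}` is profile time `−1`;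
* new steps (5b)–(5d) produce a floor `κ ≤ C(r; v', 0)` (`0 < r ≤ r₂`) with `κ` UNIFORM in the solution: the
  space–time local Type-I bound `M` passes to `v'` as the rate `(max M 0/ν)/(‖y‖+√−s)` on `Q(1)`, whence
  `C(r; v', 0) ≤ e = 6|B₁|(max M 0/ν)³` (`StableStrataDoorVertexBounds.cknC_le_of_spaceTimeRate`), whence
  `D(r; π', 0) ≤ L(e)` at small scales (`….exists_cknD_le_of_cknC_le`, Seregin–Šverák (as13) iterated), whence the
  floor by Seregin's `κ(L)` (hypothesis `Hκ` = the conclusion of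
  `Seregin2020CubicLowerBound.exists_le_cknC_of_isBackwardSingularPoint L`, to be supplied by the caller BEFORE the
  solution is fixed); the floor is transported to the limit `w` at EVERY scale.

WHAT THIS IS NOT: not NS regularity (Clay A); a compactness frame for an input of a criterion INSIDE the Type-I class;
no route, no item.
-/

noncomputable section

set_option linter.dupNamespace false

namespace Summit.NavierStokesRegularity.NavierStokesRegularity.Theorems.StableStrataDoorZoomFrameAlong

open MeasureTheory Set Function Filter Topology TopologicalSpace Metric
open Literature.Analysis Literature.Analysis.FluidPDE Literature.Analysis.FluidPDE.SereginSverak2009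
open Summit.NavierStokesRegularity.NavierStokesRegularity.Theorems
open Summit.NavierStokesRegularity.NavierStokesRegularity.Theorems.LocalSineTubeDoorLocalPointZoomZoom
open Summit.NavierStokesRegularity.NavierStokesRegularity.Theorems.LocalSineTubeDoorLocalPointZoomRate
open Summit.NavierStokesRegularity.NavierStokesRegularity.Theorems.StableStrataDoorHalfZoomRate
open scoped NNReal ENNReal

/-- **The tree zoom frame along prescribed times with a uniform floor** (module docstring). -/
theorem localTreeZoomFrameAlong {ν T : ℝ} (hν : 0 < ν) (hT : 0 < T)
    {u : ℝ → EuclideanSpace ℝ (Fin 3) → EuclideanSpace ℝ (Fin 3)} {p : ℝ → EuclideanSpace ℝ (Fin 3) → ℝ}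
    (hsol : IsClassicalNSSolutionOn (Ico 0 T) ν 0 u p) (hLH : IsLerayHopfOn T ν 0 (u 0) u)
    {x₀ : EuclideanSpace ℝ (Fin 3)} {ρ M : ℝ} (hρ : 0 < ρ)
    (hM' : ∀ t ∈ Ico 0 T, T - ρ ^ 2 < t → ∀ x ∈ ball x₀ ρ, ‖u t x‖ * (‖x - x₀‖ + Real.sqrt (ν * (T - t))) ≤ M)
    (hnotbd : ¬ IsBackwardBoundedAt u T x₀)
    -- the prescribed physical times
    {t : ℕ → ℝ} (htT : ∀ n, t n < T) (ht : Tendsto t atTop (𝓝 T))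
    -- the absolute constants of the pressure decay estimate and a floor constant `κ` for the level `L`
    {c : ℝ≥0}
    (hPD : ∀ (Q : Opens (ℝ × EuclideanSpace ℝ (Fin 3)))
      (u : ℝ → EuclideanSpace ℝ (Fin 3) → EuclideanSpace ℝ (Fin 3)) (p : ℝ → EuclideanSpace ℝ (Fin 3) → ℝ),
      IsDistributionalNSSolutionOn Q 1 0 u p →
      ∀ (z : ℝ × EuclideanSpace ℝ (Fin 3)) (r θ : ℝ), 0 < r → 0 < θ → θ ≤ 1 →
        parabolicCylinder r z ⊆ (Q : Set (ℝ × EuclideanSpace ℝ (Fin 3))) →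
        cknD (θ * r) z p ≤
          c * (ENNReal.ofReal θ * cknD r z p + ENNReal.ofReal ((θ⁻¹) ^ 2) * cknC r z u))
    {θ : ℝ} (hθ : 0 < θ) (hθ1 : θ < 1) (hcθ : (c : ℝ≥0∞) * ENNReal.ofReal θ ≤ 2⁻¹)
    {L : ℝ≥0} (hL : ENNReal.ofReal ((θ⁻¹) ^ 2) * (1 + 2 * ((c : ℝ≥0∞) * ENNReal.ofReal ((θ⁻¹) ^ 2) *
      ENNReal.ofReal (6 * volume.real (ball (0 : EuclideanSpace ℝ (Fin 3)) 1) * (max M 0 / ν) ^ 3))) ≤ L)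
    {κ : ℝ}
    (Hκ : ∀ (Q : Opens (ℝ × EuclideanSpace ℝ (Fin 3)))
        (u : ℝ → EuclideanSpace ℝ (Fin 3) → EuclideanSpace ℝ (Fin 3))
        (p : ℝ → EuclideanSpace ℝ (Fin 3) → ℝ)
        (G : ℝ → EuclideanSpace ℝ (Fin 3) → EuclideanSpace ℝ (Fin 3) →L[ℝ] EuclideanSpace ℝ (Fin 3)),
        IsSuitableWeakSolutionOn Q 1 0 u p → HasWeakSpatialGradientOn Q u G →
        ∀ (z : ℝ × EuclideanSpace ℝ (Fin 3)) (r₀ : ℝ), 0 < r₀ →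
          parabolicCylinder r₀ z ⊆ (Q : Set (ℝ × EuclideanSpace ℝ (Fin 3))) →
          cknAEss r₀ z u ≠ ∞ → cknE r₀ z G ≠ ∞ →
          (∀ r ∈ Ioc (0 : ℝ) r₀, cknD r z p ≤ L) →
          IsBackwardSingularPoint u z →
          ∀ r ∈ Ioc (0 : ℝ) r₀, ENNReal.ofReal κ ≤ cknC r z u) :
    ∃ (R C₁ : ℝ) (v' : ℝ → EuclideanSpace ℝ (Fin 3) → EuclideanSpace ℝ (Fin 3))
      (π' : ℝ → EuclideanSpace ℝ (Fin 3) → ℝ) (φ : ℕ → ℕ) (lam : ℕ → ℝ)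
      (w v₁ : ℝ → EuclideanSpace ℝ (Fin 3) → EuclideanSpace ℝ (Fin 3))
      (Ks : ℝ≥0) (r₁ : ℝ), 0 < R ∧ StrictMono φ ∧ (∀ j, 0 < lam j) ∧ Tendsto lam atTop (𝓝 0) ∧
      (∀ j, (R * (lam j / 2)) ^ 2 = ν * (T - t (φ j))) ∧
      IsSuitableWeakSolutionInBall 1 0 v' π' ∧ 0 < r₁ ∧ r₁ ≤ 1 ∧
      (∀ r ∈ Ioc (0 : ℝ) r₁, cknD r (0 : ℝ × EuclideanSpace ℝ (Fin 3)) π' ≤ Ks) ∧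
      (∀ a : ℝ, 0 < a → Tendsto (fun j => eLpNorm
        (uncurry ((lam j) • stPull ((lam j) ^ 2) (lam j) (0 : ℝ) (0 : EuclideanSpace ℝ (Fin 3)) v') -
          uncurry w) 3
        (volume.restrict (parabolicCylinder a (0 : ℝ × EuclideanSpace ℝ (Fin 3))))) atTop (𝓝 0)) ∧
      (∀ a : ℝ, 0 < a → ENNReal.ofReal κ ≤ cknC a (0 : ℝ × EuclideanSpace ℝ (Fin 3)) w) ∧
      (∀ᵐ x ∂(volume.restrict (Iio (0 : ℝ) ×ˢ (univ : Set (EuclideanSpace ℝ (Fin 3))))),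
        uncurry w x = uncurry v₁ x) ∧
      (HasTypeITimeDecay C₁ v₁ ∧ ContinuousOn (uncurry v₁) (Iio (0 : ℝ) ×ˢ univ) ∧
        (∀ s t : ℝ, s < t → t < 0 → ∀ x, v₁ t x =
          UnboundedOperators.heatExtension (v₁ s) (t - s) x - oseenDuhamel 1 s v₁ v₁ t x) ∧
        (∀ t < 0, VectorCalculus.IsDivFree (v₁ t))) ∧
      IsBackwardSingularPoint v₁ 0 ∧
      ∀ (j : ℕ) (s : ℝ) (y : EuclideanSpace ℝ (Fin 3)),
        ((lam j) • stPull ((lam j) ^ 2) (lam j) (0 : ℝ) (0 : EuclideanSpace ℝ (Fin 3)) v') s y =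
          ((R * (lam j / 2)) / ν) • u (T + (R * (lam j / 2)) ^ 2 * s / ν) (x₀ + (R * (lam j / 2)) • y) := by
  -- ## (0) the time-only rate from the space–time bound
  have hM : ∀ t ∈ Ico 0 T, T - ρ ^ 2 < t → ∀ x ∈ ball x₀ ρ, ‖u t x‖ * Real.sqrt (ν * (T - t)) ≤ M := by
    intro t' ht' hlt x hx
    refine le_trans ?_ (hM' t' ht' hlt x hx)
    exact mul_le_mul_of_nonneg_left (le_add_of_nonneg_left (norm_nonneg _)) (norm_nonneg _)
  -- ## (1) the viscosity-normalising zoom at the locally Type I point (A–B Lemma 2.5, rate case)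
  obtain ⟨R, α, β, hR, hα, hβ, hβR, hαR, hβT, hRρ, hβρ, hball, hGv, hratev, htypeI⟩ :=
    exists_zoom_typeIBound_lt_top_of_localTypeI hν hT hsol hLH hρ hM
  have hρR : 0 < ρ / R := div_pos hρ hR
  set q : ℝ → EuclideanSpace ℝ (Fin 3) → ℝ :=
    fun t x => p t x - (p t 0 - normalisedPressure (u t) 0) with hq
  set v : ℝ → EuclideanSpace ℝ (Fin 3) → EuclideanSpace ℝ (Fin 3) := α • stPull β R T x₀ u with hv
  set πv : ℝ → EuclideanSpace ℝ (Fin 3) → ℝ := α ^ 2 • stPull β R T x₀ q with hπv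
  set Gv : ℝ → EuclideanSpace ℝ (Fin 3) → EuclideanSpace ℝ (Fin 3) →L[ℝ] EuclideanSpace ℝ (Fin 3) :=
    (α * R) • stPull β R T x₀ (fun t x => fderiv ℝ (u t) x) with hGvdef
  -- ## (2) the origin is a backward singular point of the zoom
  have hsing : IsBackwardSingularPoint v (0 : ℝ × EuclideanSpace ℝ (Fin 3)) := by
    intro r hr
    by_contra hfin
    have hfin' : eLpNorm (uncurry v) ⊤
        (volume.restrict (parabolicCylinder (min r 1) (0 : ℝ × EuclideanSpace ℝ (Fin 3)))) < ⊤ := by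
      refine lt_of_le_of_lt (eLpNorm_mono_measure _ (Measure.restrict_mono ?_ le_rfl))
        (lt_top_iff_ne_top.2 hfin)
      exact SuitableCompactness.parabolicCylinder_zero_mono (le_min hr.le zero_le_one) (min_le_left _ _)
    exact hnotbd (SereginSverak2002.isBackwardBoundedAt_of_zoom hsol x₀ hR hα hβ hβT
      (lt_min hr one_pos) (min_le_right _ _) hfin')
  -- ## (3) the rate of the zoom on `(-1, 0) × B(0, ρ/R)` (from the LOCAL rate of `u`)
  set C₁ : ℝ := α * max M 0 / Real.sqrt (ν * β) with hC₁def
  have hC₁ : 0 ≤ C₁ := by positivity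
  -- ## (4) the second zoom by `1/2`: the class on `Q(0, 2) ⊇ 𝒞 × (−1, 0)`
  have hc : (0 : ℝ) < 1 / 2 := by norm_num
  set v' : ℝ → EuclideanSpace ℝ (Fin 3) → EuclideanSpace ℝ (Fin 3) :=
    (1 / 2 : ℝ) • stPull ((1 / 2 : ℝ) ^ 2) (1 / 2) (0 : ℝ) (0 : EuclideanSpace ℝ (Fin 3)) v with hv'
  set π' : ℝ → EuclideanSpace ℝ (Fin 3) → ℝ :=
    (1 / 2 : ℝ) ^ 2 • stPull ((1 / 2 : ℝ) ^ 2) (1 / 2) (0 : ℝ) (0 : EuclideanSpace ℝ (Fin 3)) πv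
    with hπ'
  set G' : ℝ → EuclideanSpace ℝ (Fin 3) → EuclideanSpace ℝ (Fin 3) →L[ℝ] EuclideanSpace ℝ (Fin 3) :=
    (1 / 2 : ℝ) ^ 2 • stPull ((1 / 2 : ℝ) ^ 2) (1 / 2) (0 : ℝ) (0 : EuclideanSpace ℝ (Fin 3)) Gv
    with hG'def
  have hball' : IsSuitableWeakSolutionInBall 2 0 v' π' := by
    have h := hball.zoomOut hc
    rwa [show (1 : ℝ) / (1 / 2) = 2 by norm_num] at h
  have hG' : HasWeakSpatialGradientOn
      (parabolicCylinderOpens 2 (0 : ℝ × EuclideanSpace ℝ (Fin 3))) v' G' := by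
    have h := hGv.stRescale (1 / 2 : ℝ) (pow_pos hc 2) hc (0 : ℝ) (0 : EuclideanSpace ℝ (Fin 3))
    have hpre : stPreimage ((1 / 2 : ℝ) ^ 2) (1 / 2) (0 : ℝ) (0 : EuclideanSpace ℝ (Fin 3))
        (parabolicCylinderOpens 1 (0 : ℝ × EuclideanSpace ℝ (Fin 3))) =
        parabolicCylinderOpens 2 (0 : ℝ × EuclideanSpace ℝ (Fin 3)) := by
      apply Opens.ext
      rw [coe_stPreimage, coe_parabolicCylinderOpens, coe_parabolicCylinderOpens,
        stAffine_preimage_parabolicCylinder_zero hc, show (1 : ℝ) / (1 / 2) = 2 by norm_num]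
    rw [hpre, ← sq] at h
    exact h
  have hI' : typeIBound (parabolicCylinder 1 (0 : ℝ × EuclideanSpace ℝ (Fin 3))) v' π' G' < ⊤ := by
    have h := typeIBound_nsZoom hc (0 : ℝ) (0 : EuclideanSpace ℝ (Fin 3))
      (parabolicCylinder (1 / 2) (0 : ℝ × EuclideanSpace ℝ (Fin 3))) v πv Gv
    rw [stAffine_preimage_parabolicCylinder_zero hc, show (1 / 2 : ℝ) / (1 / 2) = 1 by norm_num] at h
    rw [hv', hπ', hG'def, h]
    exact htypeI
  have hsing' : IsBackwardSingularPoint v' (0 : ℝ × EuclideanSpace ℝ (Fin 3)) := by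
    intro r hr
    rw [hv', eLpNorm_top_nsZoom hc, Seregin2020.stAffine_zero_zero_apply_zero,
      hsing ((1 / 2) * r) (by positivity)]
    exact ENNReal.mul_top (by simp)
  have hratev' : ∀ s ∈ Ioo (-((1 : ℝ) / (1 / 2 : ℝ) ^ 2)) 0,
      ∀ y ∈ ball (0 : EuclideanSpace ℝ (Fin 3)) ((ρ / R) / (1 / 2 : ℝ)), ‖v' s y‖ ≤ C₁ / Real.sqrt (-s) :=
    fun s hs y hy => norm_nsZoom_le_rate_of_ball hc hratev hs hy
  -- ## (5) the inputs of the zoom-in extraction on `𝒞 × (−1, 0) ⊆ Q(0, 2)`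
  have hsqrt2 : Real.sqrt 2 ≤ 2 := by
    rw [Real.sqrt_le_left (by norm_num)]
    norm_num
  have hPQ : parCyl (0 : ℝ × EuclideanSpace ℝ (Fin 3)) 1 ⊆
      parabolicCylinder 2 (0 : ℝ × EuclideanSpace ℝ (Fin 3)) := by
    intro z hz
    obtain ⟨ht, hx⟩ := hz
    have hx' := spaceCyl_subset_ball (0 : EuclideanSpace ℝ (Fin 3)) zero_le_one hx
    rw [mul_one, mem_ball_zero_iff] at hx'
    simp only [Prod.fst_zero, one_pow, zero_sub, mem_Ioo] at ht
    rw [SuitableCompactness.mem_parabolicCylinder_zero]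
    exact ⟨⟨by linarith [ht.1], ht.2⟩, lt_of_lt_of_le hx' hsqrt2⟩
  have hle : parCylOpens (0 : ℝ × EuclideanSpace ℝ (Fin 3)) 1 ≤
      parabolicCylinderOpens 2 (0 : ℝ × EuclideanSpace ℝ (Fin 3)) := fun z hz => hPQ hz
  have hsw3 : IsSuitableWeakSolutionOn (parCylOpens (0 : ℝ × EuclideanSpace ℝ (Fin 3)) 1) 1 0 v' π' :=
    IsSuitableWeakSolutionOn.mono_holds hball'.1 hle
  have hA3 : ∃ Cc : ℝ≥0, ∀ᵐ t ∂(volume.restrict (Ioo (-1 : ℝ) 0)),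
      ∫⁻ x in spaceCyl (0 : EuclideanSpace ℝ (Fin 3)) 1, ‖v' t x‖ₑ ^ 2 ≤ Cc := by
    obtain ⟨Cc, hCc⟩ := hball'.2.1
    refine ⟨Cc, ?_⟩
    have hsub : Ioo (-1 : ℝ) 0 ⊆ Ioo ((0 : ℝ × EuclideanSpace ℝ (Fin 3)).1 - 2 ^ 2)
        (0 : ℝ × EuclideanSpace ℝ (Fin 3)).1 := by
      intro t ht
      simp only [Prod.fst_zero, zero_sub, mem_Ioo]
      exact ⟨by linarith [ht.1], ht.2⟩
    have hballsub : spaceCyl (0 : EuclideanSpace ℝ (Fin 3)) 1 ⊆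
        ball (0 : ℝ × EuclideanSpace ℝ (Fin 3)).2 2 := by
      refine (spaceCyl_subset_ball (0 : EuclideanSpace ℝ (Fin 3)) zero_le_one).trans ?_
      rw [mul_one, Prod.snd_zero]
      exact ball_subset_ball hsqrt2
    filter_upwards [ae_restrict_of_ae_restrict_of_subset hsub hCc] with t ht
    exact (lintegral_mono_set hballsub).trans ht
  have hG3 : HasWeakSpatialGradientOn (parCylOpens (0 : ℝ × EuclideanSpace ℝ (Fin 3)) 1) v' G' :=
    hG'.mono hle
  have hE3 : ∫⁻ z in parCyl (0 : ℝ × EuclideanSpace ℝ (Fin 3)) 1,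
      ENNReal.ofReal (frobeniusNormSq (G' z.1 z.2)) < ∞ := by
    obtain ⟨G'', hG'', hG''2⟩ := hball'.2.2.1
    have hae := hG'.ae_eq hG''
    rw [coe_parabolicCylinderOpens] at hae
    refine lt_of_le_of_lt (lintegral_mono_set hPQ) ?_
    have e : ∫⁻ z in parabolicCylinder 2 (0 : ℝ × EuclideanSpace ℝ (Fin 3)),
        ENNReal.ofReal (frobeniusNormSq (G' z.1 z.2)) =
        ∫⁻ z in parabolicCylinder 2 (0 : ℝ × EuclideanSpace ℝ (Fin 3)),
        ENNReal.ofReal (frobeniusNormSq (G'' z.1 z.2)) := by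
      refine lintegral_congr_ae ?_
      filter_upwards [hae] with z hz
      have hz' : G' z.1 z.2 = G'' z.1 z.2 := hz
      rw [hz']
    rw [e]
    exact hG''2
  have hp3 : ∫⁻ z in parCyl (0 : ℝ × EuclideanSpace ℝ (Fin 3)) 1,
      ‖π' z.1 z.2‖ₑ ^ (3 / 2 : ℝ) < ∞ := by
    obtain ⟨h32, h32', h32r⟩ := threeHalves_facts
    have hm : MemLp (uncurry π') (3 / 2)
        (volume.restrict (parabolicCylinder 2 (0 : ℝ × EuclideanSpace ℝ (Fin 3)))) := hball'.2.2.2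
    have h2 := hm.2
    rw [eLpNorm_eq_lintegral_rpow_enorm_toReal (by norm_num) h32', h32r] at h2
    have hfin : ∫⁻ z in parabolicCylinder 2 (0 : ℝ × EuclideanSpace ℝ (Fin 3)),
        ‖uncurry π' z‖ₑ ^ (3 / 2 : ℝ) < ∞ := by
      by_contra htop
      rw [not_lt, top_le_iff] at htop
      rw [htop, ENNReal.top_rpow_of_pos (by norm_num)] at h2
      exact lt_irrefl _ h2
    exact lt_of_le_of_lt (lintegral_mono_set hPQ) hfin
  have hI3 : Seregin2020.blowupIndex 0 v' G' < ∞ := by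
    refine lt_of_le_of_lt (Seregin2020.blowupIndex_le_limsup_cknC 0 v' G') (lt_of_le_of_lt ?_ hI')
    refine limsup_le_of_le (by isBoundedDefault) ?_
    filter_upwards [Ioo_mem_nhdsGT (zero_lt_one' ℝ)] with r hr
    exact cknC_le_abScaledSum.trans (abScaledSum_le_typeIBound hr.1
      (SuitableCompactness.parabolicCylinder_zero_mono hr.1.le hr.2.le))
  -- ## (5b) the space–time rate of `v'` on `Q(1)` and the UNIFORM cubic bound `C(r; v', 0) ≤ e(ν, M)`
  set D₀ : ℝ := max M 0 / ν with hD₀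
  have hD₀nn : 0 ≤ D₀ := div_nonneg (le_max_right _ _) hν.le
  have hrate_st : ∀ s ∈ Ioo (-(1 : ℝ) ^ 2) 0, ∀ y ∈ ball (0 : EuclideanSpace ℝ (Fin 3)) 1,
      ‖v' s y‖ ≤ D₀ / (‖y‖ + Real.sqrt (-s)) := by
    rw [hv', hv, hD₀]
    exact halfZoom_spaceTimeRate hν hR hα hβR hαR hβT hRρ hβρ hM'
  have hCe : ∀ r ∈ Ioc (0 : ℝ) 1, cknC r (0 : ℝ × EuclideanSpace ℝ (Fin 3)) v' ≤
      ENNReal.ofReal (6 * volume.real (ball (0 : EuclideanSpace ℝ (Fin 3)) 1) * D₀ ^ 3) :=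
    fun r hr => StableStrataDoorVertexBounds.cknC_le_of_spaceTimeRate hD₀nn hrate_st hr
  -- ## (5c) the scaled pressure below the uniform level `L` at small scales
  have hQ1 : parabolicCylinder 1 (0 : ℝ × EuclideanSpace ℝ (Fin 3)) ⊆
      ((parCylOpens (0 : ℝ × EuclideanSpace ℝ (Fin 3)) 1 : Opens (ℝ × EuclideanSpace ℝ (Fin 3))) :
        Set (ℝ × EuclideanSpace ℝ (Fin 3))) := by
    rw [coe_parCylOpens]
    exact parabolicCylinder_subset_parCyl 0 1
  have hD1 : cknD 1 (0 : ℝ × EuclideanSpace ℝ (Fin 3)) π' ≠ ∞ := by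
    rw [cknD]
    refine ENNReal.mul_ne_top (by simp) (lt_of_le_of_lt (lintegral_mono_set ?_) hp3).ne
    exact parabolicCylinder_subset_parCyl 0 1
  obtain ⟨r₂, hr₂, hDr₂⟩ := StableStrataDoorVertexBounds.exists_cknD_le_of_cknC_le hPD hθ hθ1 hcθ
    hsw3.distributional one_pos hQ1 hD1 hCe
  have hDL : ∀ r ∈ Ioc (0 : ℝ) r₂, cknD r (0 : ℝ × EuclideanSpace ℝ (Fin 3)) π' ≤ L :=
    fun r hr => (hDr₂ r hr).trans hL
  -- ## (5d) the UNIFORM floor `κ ≤ C(r; v', 0)` for `0 < r ≤ r₂`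
  have hsub₂ : parabolicCylinder r₂ (0 : ℝ × EuclideanSpace ℝ (Fin 3)) ⊆
      ((parCylOpens (0 : ℝ × EuclideanSpace ℝ (Fin 3)) 1 : Opens (ℝ × EuclideanSpace ℝ (Fin 3))) :
        Set (ℝ × EuclideanSpace ℝ (Fin 3))) :=
    (parabolicCylinder_mono hr₂.1.le hr₂.2 _).trans hQ1
  have hab₂ : abScaledSum r₂ (0 : ℝ × EuclideanSpace ℝ (Fin 3)) v' π' G' < ∞ :=
    lt_of_le_of_lt (abScaledSum_le_typeIBound hr₂.1 (parabolicCylinder_mono hr₂.1.le hr₂.2 _)) hI'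
  have hfloor : ∀ r ∈ Ioc (0 : ℝ) r₂, ENNReal.ofReal κ ≤ cknC r (0 : ℝ × EuclideanSpace ℝ (Fin 3)) v' :=
    Hκ _ v' π' G' hsw3 hG3 0 r₂ hr₂.1 hsub₂ (lt_of_le_of_lt cknAEss_le_abScaledSum hab₂).ne
      (lt_of_le_of_lt cknE_le_abScaledSum hab₂).ne hDL hsing'
  -- ## (6') the zoom-in limit ALONG THE PRESCRIBED SCALES `μₙ = 2 √(ν (T - tₙ)) / R`
  set μ : ℕ → ℝ := fun n => 2 * Real.sqrt (ν * (T - t n)) / R with hμdef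
  have hμ : ∀ n, 0 < μ n := fun n =>
    div_pos (mul_pos two_pos (Real.sqrt_pos.2 (mul_pos hν (by linarith [htT n])))) hR
  have hμ0 : Tendsto μ atTop (𝓝 0) := tendsto_prescribedScale ht R
  obtain ⟨φ, w, ϖ, hφ, hsingw, hlimw'⟩ :=
    Seregin2020.exists_ancientLimit_along hsw3 hA3 hG3 hE3 hp3 hsing' hI3 hr₂.1 hfloor hμ hμ0
  set lam : ℕ → ℝ := fun j => μ (φ j) with hlamdef
  have hlam : ∀ j, 0 < lam j := fun j => hμ _
  have hlam0 : Tendsto lam atTop (𝓝 0) := hμ0.comp hφ.tendsto_atTop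
  have hlimw : ∀ a : ℝ, 0 < a →
      IsSuitableWeakSolutionInBall a 0 w ϖ ∧
      MemLp (uncurry w) 3 (volume.restrict (parabolicCylinder a (0 : ℝ × EuclideanSpace ℝ (Fin 3)))) ∧
      Tendsto (fun j => eLpNorm
          (uncurry ((lam j) • stPull ((lam j) ^ 2) (lam j) (0 : ℝ) (0 : EuclideanSpace ℝ (Fin 3)) v') -
            uncurry w) 3
          (volume.restrict (parabolicCylinder a (0 : ℝ × EuclideanSpace ℝ (Fin 3))))) atTop (𝓝 0) ∧
      (∀ g : ℝ × EuclideanSpace ℝ (Fin 3) → ℝ,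
        MemLp g 3 (volume.restrict (parabolicCylinder a (0 : ℝ × EuclideanSpace ℝ (Fin 3)))) →
        Tendsto (fun j => ∫ w' in parabolicCylinder a (0 : ℝ × EuclideanSpace ℝ (Fin 3)),
            ((lam j) ^ 2 • stPull ((lam j) ^ 2) (lam j) (0 : ℝ) (0 : EuclideanSpace ℝ (Fin 3)) π')
              w'.1 w'.2 * g w')
          atTop (𝓝 (∫ w' in parabolicCylinder a (0 : ℝ × EuclideanSpace ℝ (Fin 3)), ϖ w'.1 w'.2 * g w'))) :=
    fun a ha => ⟨(hlimw' a ha).1, (hlimw' a ha).2.1, (hlimw' a ha).2.2.1, (hlimw' a ha).2.2.2.1⟩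
  have hlam_sq : ∀ j, (R * (lam j / 2)) ^ 2 = ν * (T - t (φ j)) := by
    intro j
    have hpos : 0 ≤ ν * (T - t (φ j)) := (mul_pos hν (by linarith [htT (φ j)])).le
    have e : R * (lam j / 2) = Real.sqrt (ν * (T - t (φ j))) := by
      show R * (2 * Real.sqrt (ν * (T - t (φ j))) / R / 2) = _
      field_simp
    rw [e, Real.sq_sqrt hpos]
  clear_value lam μ
  -- ## (7) the slab class with `𝐈 ≤ 4 𝐈(Q(0,1))`
  have hball1 : IsSuitableWeakSolutionInBall 1 0 v' π' :=
    SuitableCompactness.isSuitableWeakSolutionInBall_of_le_radius hball' (by norm_num) (by norm_num)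
  have hG1 : HasWeakSpatialGradientOn
      (parabolicCylinderOpens 1 (0 : ℝ × EuclideanSpace ℝ (Fin 3))) v' G' :=
    hG'.mono (SuitableCompactness.parabolicCylinderOpens_zero_mono (by norm_num) (by norm_num))
  obtain ⟨hsww, H, hH, h4I⟩ := slab_typeIBound_of_zoomLimit
    (typeIBound (parabolicCylinder 1 (0 : ℝ × EuclideanSpace ℝ (Fin 3))) v' π' G') hI' one_pos
    hball1 hG1 le_rfl hlam hlam0
    (fun a ha => ⟨(hlimw a ha).1, (hlimw a ha).2.1, (hlimw a ha).2.2.1, (hlimw a ha).2.2.2⟩)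
  -- ## (8) the rate, almost everywhere on the slab
  have hvm : ∀ a : ℝ, 0 < a → ∀ᶠ j in atTop, AEStronglyMeasurable
      (uncurry ((lam j) • stPull ((lam j) ^ 2) (lam j) (0 : ℝ) (0 : EuclideanSpace ℝ (Fin 3)) v'))
      (volume.restrict (parabolicCylinder a (0 : ℝ × EuclideanSpace ℝ (Fin 3)))) := by
    intro a ha
    have hev : ∀ᶠ j in atTop, lam j < 1 / a := hlam0 (Iio_mem_nhds (by positivity))
    filter_upwards [hev] with j hj
    have hμ := hlam j
    have h := hG1.stRescale (lam j) (pow_pos hμ 2) hμ (0 : ℝ) (0 : EuclideanSpace ℝ (Fin 3))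
    have hsub : parabolicCylinder a (0 : ℝ × EuclideanSpace ℝ (Fin 3)) ⊆
        ((stPreimage ((lam j) ^ 2) (lam j) (0 : ℝ) (0 : EuclideanSpace ℝ (Fin 3))
          (parabolicCylinderOpens 1 (0 : ℝ × EuclideanSpace ℝ (Fin 3))) :
            Opens (ℝ × EuclideanSpace ℝ (Fin 3))) : Set (ℝ × EuclideanSpace ℝ (Fin 3))) := by
      rw [coe_stPreimage, coe_parabolicCylinderOpens, stAffine_preimage_parabolicCylinder_zero hμ]
      refine SuitableCompactness.parabolicCylinder_zero_mono ha.le ?_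
      rw [le_div_iff₀ hμ, mul_comm]
      exact ((lt_div_iff₀ ha).1 hj).le
    exact h.locallyIntegrableOn.aestronglyMeasurable.mono_measure (Measure.restrict_mono hsub le_rfl)
  have hae_rate := ae_rate_of_zoomLimit_of_ball (by positivity : (0 : ℝ) < (1 : ℝ) / (1 / 2 : ℝ) ^ 2)
    (by positivity : (0 : ℝ) < (ρ / R) / (1 / 2 : ℝ)) hratev' hlam hlam0 hvm
    (fun a ha => ⟨(hlimw a ha).2.1.1, (hlimw a ha).2.2.1⟩)
  -- ## (9) a representative with the pointwise rate
  have h4top : typeIBound (Iio (0 : ℝ) ×ˢ univ) w ϖ H < ∞ :=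
    lt_of_le_of_lt h4I (ENNReal.mul_lt_top (by simp) hI')
  obtain ⟨v₁, hae, hP, hsing₁⟩ := exists_profile_repr hC₁ hsww hH h4top hsingw hae_rate
  -- ## (10) the zoom variables: `λⱼ • (v' ∘ λⱼ) = zoomU ν T x₀ u (R λⱼ / 2)`
  have hpt : ∀ (j : ℕ) (s : ℝ) (y : EuclideanSpace ℝ (Fin 3)),
      ((lam j) • stPull ((lam j) ^ 2) (lam j) (0 : ℝ) (0 : EuclideanSpace ℝ (Fin 3)) v') s y =
        ((R * (lam j / 2)) / ν) • u (T + (R * (lam j / 2)) ^ 2 * s / ν) (x₀ + (R * (lam j / 2)) • y) := by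
    intro j s y
    rw [smul_stPull_apply, hv', smul_stPull_apply, hv, smul_stPull_apply]
    simp only [zero_add]
    have e1 : T + β * ((1 / 2 : ℝ) ^ 2 * ((lam j) ^ 2 * s)) = T + (R * (lam j / 2)) ^ 2 * s / ν := by
      rw [hβR]; ring
    have e2 : x₀ + R • ((1 / 2 : ℝ) • ((lam j) • y)) = x₀ + (R * (lam j / 2)) • y := by
      rw [smul_smul, smul_smul, show R * (1 / 2) * lam j = R * (lam j / 2) by ring]
    rw [e1, e2, smul_smul, smul_smul, hαR, show lam j * (1 / 2) * (R / ν) = R * (lam j / 2) / ν by ring]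
  -- ## (11) Seregin's scaled energies (pressure) at the singular origin of `v'`
  obtain ⟨Ks, κ', -, r₁, hr₁, hr₁1, hKs⟩ :=
    Seregin2020.typeI_singular_scaledEnergies hsw3 hA3 hG3 hE3 hp3 hsing' hI3
  exact ⟨R, C₁, v', π', φ, lam, w, v₁, Ks, r₁, hR, hφ, hlam, hlam0, hlam_sq, hball1, hr₁, hr₁1,
    fun r hr => le_trans le_add_self (hKs r hr).1, fun a ha => (hlimw a ha).2.2.1,
    fun a ha => (hlimw' a ha).2.2.2.2, hae, hP, hsing₁, hpt⟩


end Summit.NavierStokesRegularity.NavierStokesRegularity.Theorems.StableStrataDoorZoomFrameAlong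

end
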